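import Literature.NumberTheory.EllipticCurves.NewformPeterssonSizePairReductionProofs
import Literature.NumberTheory.EllipticCurves.CuspFormLFunctionLevelConductorProofs
import Literature.NumberTheory.EllipticCurves.QuadraticTwistTwoLFunctionProofs
import Literature.NumberTheory.EllipticCurves.QuadraticTwistKroneckerLFunctionProofs
import Literature.NumberTheory.EllipticCurves.QuadraticTwistRamifiedLocalPolynomialProofs
import Literature.NumberTheory.EllipticCurves.ComplexMultiplicationShaKnappProofs
import Literature.NumberTheory.EllipticCurves.ModularityVersionAp
import Literature.NumberTheory.QuadraticFields.FundamentalDiscriminant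
import HarnessLib

/-!
# Twist classes of elliptic newforms: `Re L(Sym² f, 1) ≫_δ N^{−δ}` on every family of fixed
# `j`-invariant `j₀ ≠ 0, 1728` (the twist-equivalent case of Hoffstein–Lockhart), proved

Topic `NumberTheory/EllipticCurves`; namespace `Literature.NumberTheory.EllipticCurves.ModularForms`
(and three dot-notation coefficient lemmas in `WeierstrassCurve`). A proofs-only file: theorems only,
no definition, no named fact (D-0026). Filed in support of the named fact
`murty_petersson_newform_lower_bound` (`NewformPeterssonSize`; Murty 1999 (3) ⇐ Hoffstein–Lockhart
1994, Thm. 0.1), which the tree reduces (`murty_petersson_newform_lower_bound_of_pairData_nonCM`,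
`NewformPeterssonSizePairReductionProofs`) to `GL₃` pair data for the non-CM, non-twist-equivalent
pairs plus a direct bound `hCM` on the CM newforms. Here the direct bound is PROVED on every family of
elliptic newforms of a FIXED `j`-invariant `j₀ ≠ 0, 1728` — in particular on eleven of the thirteen
CM `j`-invariants (`WeierstrassCurve.cmJInvariants` minus `0, 1728`; the family `j = 1728` is the
sibling file `NewformSymmSquareJ1728Hecke`, and `j = 0` would need Hecke `L`-functions of `ℚ(√−3)`).

## The argument (Hoffstein–Lockhart 1994, proof of Thm. 0.1, the twist-equivalent case)

Two elliptic curves over `ℚ` with the same `j`-invariant `≠ 0, 1728` differ by a quadratic twist by a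
squarefree integer `d` (`exists_variableChange_eq_quadraticTwist_intCast_of_j_eq`, Silverman X.5
Cor. 5.4.1). For their newforms `f_i`, `f_j` and a prime `p ∤ N_iN_j` (good for both curves, since the
level and the conductor have the same primes, `IsNewformOf.dvd_level_iff_dvd_conductorNorm`):

* `p` does not divide the discriminant `d_K ∈ {d, 4d}` of `K = ℚ(√d)`
  (`exists_numberField_discr_eq`): otherwise the local Euler factor of `E_i^{(d_K)} ≅ E_j` at `p` is
  trivial (`localEulerFactor_quadraticTwist_discr_eq_one_of_dvd`, Ireland–Rosen Prop. 20.5.4(b)), so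
  `a_p(f_j) = a_{p²}(f_j) = 0`, contradicting the Hecke relation `a_{p²} = a_p² − p` off the level
  (`IsNewform0.cuspCoeff_prime_pow_add_two`);
* hence the twist is unramified at `p` and `a_p(f_j) = ±a_p(f_i)`: by the Legendre symbol `(d/p)` at
  odd `p` (`localEulerFactor_quadraticTwist_intCast_of_not_dvd`) and by `(2/|d|)` at `p = 2`, where
  then `d ≡ 1 (mod 4)` (`localEulerFactor_quadraticTwist_two_of_emod_four_eq_one`).

So the two newforms are `TwistEquiv` (`twistEquiv_of_smul_eq_quadraticTwist`, `twistEquiv_of_j_eq`),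
and the tree's twist-equivalent case `twistEquiv_equiv_case` (`RankinSymmSquareTwistComparison`:
`Re L_{f_i}(1) ≥ D(δ)(N_iN_j)^{−δ} Re L_{f_j}(1)`) compared with ONE fixed member of the family gives
the bound with a constant depending on `δ` and `j₀` only (`exists_symmSqL_one_re_ge_of_j_eq`); finite
unions (`exists_symmSqL_one_re_ge_of_j_mem`), the eleven CM invariants
(`exists_symmSqL_one_re_ge_of_j_mem_cmJInvariants`, `exists_symmSqLOne_ge_of_j_mem_cmJInvariants`,
`hCM_or_j_mem_cmJInvariants`) and Murty's Petersson form `c N^{1−ε} ≤ Re (f,f)`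
(`exists_petersson_ge_of_j_eq`) follow.

## References

* J. Hoffstein, P. Lockhart, *Coefficients of Maass forms and the Siegel zero*, Ann. of Math. 140
  (1994), 161–181, Thm. 0.1 (proof, the twist-equivalent case). [cite: HoffsteinLockhart1994, Thm. 0.1]
* M. R. Murty, *Bounds for congruence primes*, Proc. Sympos. Pure Math. 66.1 (1999), §2, (3).
  [cite: MurtyCongruencePrimes1999, §2 (3)]
* J. H. Silverman, *The Arithmetic of Elliptic Curves*, 2nd ed. (2009), X.2 Prop. 2.4, X.5 Cor. 5.4,
  5.4.1, Exercise 10.16, App. C §11 and §16. [cite: SilvermanAEC2009, X.5 Cor. 5.4.1]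
* K. Ireland, M. Rosen, *A Classical Introduction to Modern Number Theory*, 2nd ed. (1990), Ch. 20 §5,
  Prop. 20.5.4(b). [cite: IrelandRosen1990, Prop. 20.5.4(b)]
* F. Diamond, J. Shurman, *A First Course in Modular Forms* (2005), Prop. 5.8.5, §8.3.

## Mathlib / tree search

Tree: `TwistEquiv`, `twistEquiv_equiv_case`, `TwistEquiv.symm` (`RankinSymmSquareTwistComparison`);
`EllipticNewformIndex`, `symmSqL_one`, `symmSqL_one_re_pos`, `symmSqL_one_re_le_symmSqLOne`,
`IsNewformOf.peterssonProduct_re_pos`, `le_gamma0Index` (`NewformPeterssonSizePairReductionProofs` and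
its imports); `IsNewformOf.dvd_level_iff_dvd_conductorNorm` (`CuspFormLFunctionLevelConductorProofs`);
`WeierstrassCurve.dvd_conductorNorm_iff`, `IsNewform0.cuspCoeff_prime_pow_add_two`,
`WeierstrassCurve.LFunction_apply_prime_pow` (`ModularityVersionAp(Proofs)`);
`localEulerFactor_quadraticTwist_intCast_of_not_dvd` (`QuadraticTwistTwoLFunctionProofs`),
`localEulerFactor_quadraticTwist_two_of_emod_four_eq_one` (`QuadraticTwistKroneckerLFunctionProofs`),
`localEulerFactor_quadraticTwist_discr_eq_one_of_dvd` (`QuadraticTwistRamifiedLocalPolynomialProofs`);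
`exists_variableChange_eq_quadraticTwist_intCast_of_j_eq` (`ComplexMultiplicationShaKnappProofs`),
`exists_variableChange_quadraticTwist_mul_sq`, `exists_variableChange_quadraticTwist_one`,
`isElliptic_quadraticTwist`, `LFunction_smul`, `WeierstrassCurve.cmJInvariants`;
`exists_numberField_discr_eq` (`QuadraticFields/FundamentalDiscriminant`). Mathlib:
`ArithmeticFunction.ofPowerSeries_apply_pow`, `PowerSeries.coeff_rescale`, `jacobiSym.eq_one_or_neg_one`.
-/

noncomputable section

open scoped Real Topology NumberTheorySymbols
open Set Filter Complex CongruenceSubgroup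

/-! ### Dirichlet coefficients of a quadratic twist at one prime -/

namespace WeierstrassCurve

open IsDedekindDomain IsDedekindDomain.HeightOneSpectrum NumberField Rat.HeightOneSpectrum
  ArithmeticFunction

variable (W : WeierstrassCurve ℚ) [W.IsElliptic]

/-- **`a_ℓ(E^{(d)}) = (d/ℓ) a_ℓ(E)` at an odd prime `ℓ ∤ d`** (`d ∈ ℤ`), for Mathlib's `L`-function of
the quadratic twist `E^{(d)}`: the local Euler factor of `E^{(d)}` at the place over `ℓ` is that of
`E` rescaled by the Legendre symbol `(d/ℓ)` (`localEulerFactor_quadraticTwist_intCast_of_not_dvd`),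
and `a_ℓ` is its linear coefficient (`LFunction_apply_prime_pow`). No hypothesis on the reduction of
`E` at `ℓ` or at the primes of `d`. [cite: SilvermanAEC2009, X.2 Prop. 2.4 and Exercise 10.16] -/
theorem LFunction_quadraticTwist_intCast_apply_prime_of_not_dvd (d : ℤ)
    (v : HeightOneSpectrum (𝓞 ℚ)) (hv2 : (primesEquiv v : ℕ) ≠ 2)
    (hvd : ¬ ((primesEquiv v : ℕ) : ℤ) ∣ d) :
    (W.quadraticTwist (d : ℚ)).LFunction (primesEquiv v : ℕ) =
      J(d | (primesEquiv v : ℕ)) * W.LFunction (primesEquiv v : ℕ) := by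
  have hℓ1 : 1 < (primesEquiv v : ℕ) := (primesEquiv v).2.one_lt
  have h1 := (W.quadraticTwist (d : ℚ)).LFunction_apply_prime_pow v 1
  have h2 := W.LFunction_apply_prime_pow v 1
  rw [pow_one] at h1 h2
  have key := congrArg (fun φ : ArithmeticFunction ℤ ↦ φ ((primesEquiv v : ℕ) ^ 1))
    (W.localEulerFactor_quadraticTwist_intCast_of_not_dvd d v hv2 hvd)
  simp only [localEulerFactor, natCard_residueField_adicCompletionIntegers] at key
  rw [ofPowerSeries_apply_pow hℓ1, ofPowerSeries_apply_pow hℓ1, PowerSeries.coeff_rescale,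
    pow_one] at key
  rw [h1, h2, key]

/-- **`a₂(E^{(d)}) = (2/|d|) a₂(E)` for `d ≡ 1 (mod 4)`** (the unramified twist at `2`): the local
Euler factor of `E^{(d)}` at the place over `2` is that of `E` rescaled by the Kronecker symbol
`(2/|d|)` (`localEulerFactor_quadraticTwist_two_of_emod_four_eq_one`). No hypothesis on the reduction
of `E`. [cite: SilvermanAEC2009, X.2 Prop. 2.4 and Exercise 10.16] -/
theorem LFunction_quadraticTwist_intCast_apply_two_of_emod_four_eq_one {d : ℤ} (hd4 : d % 4 = 1)
    (v : HeightOneSpectrum (𝓞 ℚ)) (hv2 : (primesEquiv v : ℕ) = 2) :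
    (W.quadraticTwist (d : ℚ)).LFunction 2 = J(2 | d.natAbs) * W.LFunction 2 := by
  have hℓ1 : 1 < (primesEquiv v : ℕ) := (primesEquiv v).2.one_lt
  have h1 := (W.quadraticTwist (d : ℚ)).LFunction_apply_prime_pow v 1
  have h2 := W.LFunction_apply_prime_pow v 1
  rw [pow_one, hv2] at h1 h2
  have key := congrArg (fun φ : ArithmeticFunction ℤ ↦ φ ((primesEquiv v : ℕ) ^ 1))
    (W.localEulerFactor_quadraticTwist_two_of_emod_four_eq_one hd4 v hv2)
  simp only [localEulerFactor, natCard_residueField_adicCompletionIntegers] at key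
  rw [ofPowerSeries_apply_pow hℓ1, ofPowerSeries_apply_pow hℓ1, PowerSeries.coeff_rescale,
    pow_one, hv2] at key
  rw [h1, h2, key]
  push_cast
  ring

/-- **`a_{p^k}(E^{(d_K)}) = 0` (`k ≥ 1`) at a prime `p ∣ d_K` of good reduction for `E`**, `K` a
quadratic field: the local Euler factor of the ramified twist at such a place is `1`
(`localEulerFactor_quadraticTwist_discr_eq_one_of_dvd`, Ireland–Rosen Prop. 20.5.4(b) by a degree
count in the Artin factorisation). [cite: IrelandRosen1990, Ch. 20 §5, Prop. 20.5.4(b)] -/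
theorem LFunction_quadraticTwist_discr_apply_prime_pow_eq_zero (K : Type) [Field K] [NumberField K]
    (h2 : Module.finrank ℚ K = 2) (v : HeightOneSpectrum (𝓞 ℚ))
    (hv : ((primesEquiv v : ℕ) : ℤ) ∣ NumberField.discr K) (hgood : W.HasGoodReductionAt v)
    {k : ℕ} (hk : k ≠ 0) :
    (W.quadraticTwist (NumberField.discr K : ℚ)).LFunction ((primesEquiv v : ℕ) ^ k) = 0 := by
  have hℓ1 : 1 < (primesEquiv v : ℕ) := (primesEquiv v).2.one_lt
  have h1 := (W.quadraticTwist (NumberField.discr K : ℚ)).LFunction_apply_prime_pow v k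
  have key := congrArg (fun φ : ArithmeticFunction ℤ ↦ φ ((primesEquiv v : ℕ) ^ k))
    (W.localEulerFactor_quadraticTwist_discr_eq_one_of_dvd K h2 v hv hgood)
  have hne : (primesEquiv v : ℕ) ^ k ≠ 1 := by
    intro h
    exact hk ((Nat.pow_eq_one.mp h).resolve_left hℓ1.ne')
  simp only [localEulerFactor, natCard_residueField_adicCompletionIntegers] at key
  rw [ofPowerSeries_apply_pow hℓ1, one_apply_ne hne] at key
  rw [h1, key]

end WeierstrassCurve

namespace Literature.NumberTheory.EllipticCurves.ModularForms

open _root_.WeierstrassCurve _root_.IsDedekindDomain _root_.NumberField Rat.HeightOneSpectrum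
open Literature.NumberTheory.LFunctions

/-! ### Good reduction and the Hecke relation at a prime off the level -/

section Level

variable (i : EllipticNewformIndex)

/-- A prime off the level of an elliptic newform is a prime of good reduction of its curve
(`p ∣ N ↔ p ∣ N_W`, `IsNewformOf.dvd_level_iff_dvd_conductorNorm`, and `p ∣ N_W ↔` bad reduction,
`dvd_conductorNorm_iff`). [cite: DiamondShurman2005, Prop. 5.8.5 and §8.3] -/
theorem EllipticNewformIndex.hasGoodReductionAt_of_not_dvd {p : ℕ} (hp : p.Prime) (hpN : ¬ p ∣ i.N)
    (v : HeightOneSpectrum (𝓞 ℚ)) (hv : (primesEquiv v : ℕ) = p) : i.W.HasGoodReductionAt v := by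
  by_contra hbad
  have h := (i.W.dvd_conductorNorm_iff v).mpr hbad
  rw [hv] at h
  exact hpN ((i.isNewformOf.dvd_level_iff_dvd_conductorNorm hp).mpr h)

/-- The Hecke relation `a_{p²}(f) = a_p(f)² − p` at a prime `p ∤ N` for a newform `f ∈ S₂(Γ₀(N))`
(`IsNewform0.cuspCoeff_prime_pow_add_two` with `e = 0`, `a₁ = 1`). [cite: DiamondShurman2005, Prop. 5.8.5] -/
theorem EllipticNewformIndex.cuspCoeff_prime_sq_of_not_dvd {p : ℕ} (hp : p.Prime) (hpN : ¬ p ∣ i.N) :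
    cuspCoeff i.f (p ^ 2) = cuspCoeff i.f p ^ 2 - p := by
  have h := i.isNewformOf.1.cuspCoeff_prime_pow_add_two hp 0
  have h1 : cuspCoeff i.f 1 = 1 := i.isNewformOf.1.2.2
  simp only [zero_add, pow_one, pow_zero, if_neg hpN, h1, mul_one] at h
  rw [h, sq]

end Level

/-! ### A quadratic twist class is twist-equivalent -/

section Twist

open Literature.NumberTheory.QuadraticFields.Quadratic

/-- A squarefree integer is not divisible by `4`. [folklore] -/
theorem not_four_dvd_of_squarefree {d : ℤ} (hsq : Squarefree d) : ¬ (4 : ℤ) ∣ d := by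
  intro h4
  have h2 : IsUnit (2 : ℤ) := hsq 2 (by simpa [show (2 : ℤ) * 2 = 4 by norm_num] using h4)
  rcases Int.isUnit_iff.mp h2 with h | h <;> norm_num at h

/-- The fundamental discriminant of `ℚ(√d)`, `d ≠ 1` squarefree: `d` if `d ≡ 1 (mod 4)`, else `4d`;
it satisfies the hypothesis of `exists_numberField_discr_eq`. [folklore] -/
theorem fundamental_of_squarefree {d : ℤ} (hsq : Squarefree d) (hd1 : d ≠ 1) :
    let D : ℤ := if d % 4 = 1 then d else 4 * d
    (D % 4 = 1 ∧ Squarefree D ∧ D ≠ 1) ∨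
      (4 ∣ D ∧ (D / 4 % 4 = 2 ∨ D / 4 % 4 = 3) ∧ Squarefree (D / 4)) := by
  intro D
  by_cases h1 : d % 4 = 1
  · left
    simp only [D, if_pos h1]
    exact ⟨h1, hsq, hd1⟩
  · right
    simp only [D, if_neg h1]
    have h4 := not_four_dvd_of_squarefree hsq
    have hdiv : 4 * d / 4 = d := by rw [Int.mul_ediv_cancel_left _ (by norm_num : (4 : ℤ) ≠ 0)]
    rw [hdiv]
    refine ⟨dvd_mul_right 4 d, ?_, hsq⟩
    have h0 : d % 4 ≠ 0 := fun h ↦ h4 (Int.dvd_of_emod_eq_zero h)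
    have := Int.emod_nonneg d (by norm_num : (4 : ℤ) ≠ 0)
    have := Int.emod_lt_of_pos d (by norm_num : (0 : ℤ) < 4)
    omega

/-- **A quadratic twist class of elliptic newforms is twist-equivalent.** If the curve of the
elliptic newform `j` is `ℚ`-isomorphic to the quadratic twist of the curve of `i` by a squarefree
integer `d ≠ 0`, then `|a_p(f_i)| = |a_p(f_j)|` at every prime `p ∤ N_iN_j` (`TwistEquiv i j`).
At such a prime both curves have good reduction; `p` cannot divide the discriminant `d_K` of
`K = ℚ(√d)` (else the local factor of `E_i^{(d_K)} ≅ E_j` at `p` would be trivial,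
`a_p(f_j) = a_{p²}(f_j) = 0`, contradicting the Hecke relation `a_{p²} = a_p² − p` off the level),
so the twist is unramified at `p` and `a_p(f_j) = ±a_p(f_i)` (`(d/p)` at odd `p`, `(2/|d|)` at
`p = 2` where then `d ≡ 1 (mod 4)`). This is the `GL₂` input "twist-equivalent forms" of the
twist-equivalent case of Hoffstein–Lockhart's theorem.
[cite: HoffsteinLockhart1994, Thm. 0.1 (proof, the twist-equivalent case)]
[cite: SilvermanAEC2009, X.2 Prop. 2.4, X.5 Cor. 5.4 and Exercise 10.16] -/
theorem twistEquiv_of_smul_eq_quadraticTwist {i j : EllipticNewformIndex} {d : ℤ} (hd0 : d ≠ 0)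
    (hsq : Squarefree d) {C : VariableChange ℚ} (hC : C • j.W = i.W.quadraticTwist (d : ℚ)) :
    TwistEquiv i j := by
  intro p hp hpN
  have hpi : ¬ p ∣ i.N := fun h ↦ hpN (h.mul_right _)
  have hpj : ¬ p ∣ j.N := fun h ↦ hpN (h.mul_left _)
  obtain ⟨v, hv⟩ : ∃ v : HeightOneSpectrum (𝓞 ℚ), (primesEquiv v : ℕ) = p :=
    ⟨primesEquiv.symm ⟨p, hp⟩, by rw [Equiv.apply_symm_apply]⟩
  have hgood : i.W.HasGoodReductionAt v := i.hasGoodReductionAt_of_not_dvd hp hpi v hv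
  have hd0' : (d : ℚ) ≠ 0 := by exact_mod_cast hd0
  haveI := i.W.isElliptic_quadraticTwist hd0'
  -- the coefficients of `f_j` are those of `E_i^{(d)}`
  have hLj : ∀ n : ℕ, cuspCoeff j.f n = ((i.W.quadraticTwist (d : ℚ)).LFunction n : ℂ) := by
    intro n
    rw [j.isNewformOf.2 n, ← hC, LFunction_smul]
  have hLi : ∀ n : ℕ, cuspCoeff i.f n = (i.W.LFunction n : ℂ) := i.isNewformOf.2
  -- the case `d = 1`: `E_j ≅ E_i`
  by_cases hd1 : d = 1
  · subst hd1
    obtain ⟨C₁, hC₁⟩ := i.W.exists_variableChange_quadraticTwist_one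
    rw [hLi, hLj, Int.cast_one, ← hC₁, LFunction_smul]
  -- the fundamental discriminant `D ∈ {d, 4d}` of `ℚ(√d)` and the field `K`
  obtain ⟨D, hDdef⟩ : ∃ D : ℤ, D = if d % 4 = 1 then d else 4 * d := ⟨_, rfl⟩
  have hDfund := fundamental_of_squarefree hsq hd1
  simp only [← hDdef] at hDfund
  obtain ⟨K, _, _, h2K, hdisc⟩ := exists_numberField_discr_eq hDfund
  have hdD : d ∣ D := by
    rw [hDdef]; split_ifs
    · exact dvd_rfl
    · exact dvd_mul_left d 4
  -- `L(E_i^{(D)}) = L(E_i^{(d)})`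
  have hLD : (i.W.quadraticTwist (D : ℚ)).LFunction = (i.W.quadraticTwist (d : ℚ)).LFunction := by
    rw [hDdef]
    split_ifs with h4
    · rfl
    · obtain ⟨C', hC'⟩ := i.W.exists_variableChange_quadraticTwist_mul_sq (d : ℚ) 2 two_ne_zero
      rw [show (((4 * d : ℤ)) : ℚ) = (d : ℚ) * 2 ^ 2 by push_cast; ring, ← hC', LFunction_smul]
  -- `p ∤ D`: otherwise `a_p(f_j) = a_{p²}(f_j) = 0`, contradicting `a_{p²} = a_p² − p`
  have hpD : ¬ (p : ℤ) ∣ D := by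
    intro hpD
    have h0 : ∀ k : ℕ, k ≠ 0 → cuspCoeff j.f (p ^ k) = 0 := by
      intro k hk
      have h := i.W.LFunction_quadraticTwist_discr_apply_prime_pow_eq_zero K h2K v
        (by rw [hv, hdisc]; exact hpD) hgood hk
      rw [hdisc, hv, hLD] at h
      rw [hLj, h, Int.cast_zero]
    have h1 := h0 1 one_ne_zero
    have h2 := h0 2 two_ne_zero
    rw [pow_one] at h1
    rw [j.cuspCoeff_prime_sq_of_not_dvd hp hpj, h1] at h2
    have : (p : ℂ) = 0 := by linear_combination -h2
    exact hp.ne_zero (by exact_mod_cast this)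
  have hpd : ¬ (p : ℤ) ∣ d := fun h ↦ hpD (h.trans hdD)
  -- the unramified twist formula at `p`
  rcases eq_or_ne p 2 with rfl | hp2
  · -- `p = 2`: `d` is odd, and `d ≡ 1 (mod 4)` (else `D = 4d` would be even)
    have hd4 : d % 4 = 1 := by
      by_contra h
      rw [hDdef, if_neg h] at hpD
      exact hpD (dvd_mul_of_dvd_left (by norm_num) d)
    have hg : (2 : ℤ).gcd d.natAbs = 1 := by
      have hodd : ¬ 2 ∣ d.natAbs := fun h ↦ hpd (Int.ofNat_dvd_left.mpr h)
      change (2 : ℤ).natAbs.gcd ((d.natAbs : ℤ)).natAbs = 1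
      rw [Int.natAbs_natCast]
      exact (Nat.Prime.coprime_iff_not_dvd Nat.prime_two).mpr hodd
    rw [hLi, hLj, i.W.LFunction_quadraticTwist_intCast_apply_two_of_emod_four_eq_one hd4 v hv]
    push_cast
    rw [norm_mul]
    rcases jacobiSym.eq_one_or_neg_one hg with h | h <;> simp [h]
  · -- `p` odd, `p ∤ d`
    have hv2 : (primesEquiv v : ℕ) ≠ 2 := by rwa [hv]
    have hvd : ¬ ((primesEquiv v : ℕ) : ℤ) ∣ d := by rwa [hv]
    have hg : d.gcd p = 1 := by
      have hodd : ¬ p ∣ d.natAbs := fun h ↦ hpd (Int.ofNat_dvd_left.mpr h)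
      change d.natAbs.gcd ((p : ℤ)).natAbs = 1
      rw [Int.natAbs_natCast]
      exact ((Nat.Prime.coprime_iff_not_dvd hp).mpr hodd).symm
    have key := i.W.LFunction_quadraticTwist_intCast_apply_prime_of_not_dvd d v hv2 hvd
    rw [hv] at key
    rw [hLi, hLj, key]
    push_cast
    rw [norm_mul]
    rcases jacobiSym.eq_one_or_neg_one hg with h | h <;> simp [h]

/-- **Two elliptic newforms whose curves have the same `j`-invariant `≠ 0, 1728` are
twist-equivalent**: the curves differ by a quadratic twist by a squarefree integer
(`exists_variableChange_eq_quadraticTwist_intCast_of_j_eq`, Silverman X.5 Cor. 5.4.1).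
[cite: SilvermanAEC2009, X.5 Prop. 5.4 and Cor. 5.4.1] -/
theorem twistEquiv_of_j_eq {i j : EllipticNewformIndex} (hj : j.W.j = i.W.j) (h0 : i.W.j ≠ 0)
    (h1728 : i.W.j ≠ 1728) : TwistEquiv i j := by
  obtain ⟨d, hd0, hsq, C, hC⟩ := exists_variableChange_eq_quadraticTwist_intCast_of_j_eq hj h0 h1728
  exact twistEquiv_of_smul_eq_quadraticTwist hd0 hsq hC

end Twist

/-! ### The lower bound on a family of fixed `j`-invariant -/

section Bounds

/-- **`Re L_{f}(1) ≫_δ N^{−δ}` on the elliptic newforms of fixed `j`-invariant `j₀ ≠ 0, 1728`.**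
All members are twist-equivalent to any fixed member `i₀` (`twistEquiv_of_j_eq`), and the
twist-equivalent case `twistEquiv_equiv_case` of Hoffstein–Lockhart gives
`Re L_{f_i}(1) ≥ D(δ) (N_i N_{i₀})^{−δ} Re L_{f_{i₀}}(1)` with `Re L_{f_{i₀}}(1) > 0`
(`symmSqL_one_re_pos`, `IsNewformOf.peterssonProduct_re_pos`); an empty family is trivial. In
particular this covers each of the eleven CM `j`-invariants other than `0, 1728` (a single
`ℚ̄`-class each). [cite: HoffsteinLockhart1994, Thm. 0.1 (proof, the twist-equivalent case)] -/
theorem exists_symmSqL_one_re_ge_of_j_eq {j₀ : ℚ} (h0 : j₀ ≠ 0) (h1728 : j₀ ≠ 1728) {δ : ℝ}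
    (hδ : 0 < δ) :
    ∃ c : ℝ, 0 < c ∧ ∀ i : EllipticNewformIndex, i.W.j = j₀ →
      c * (i.N : ℝ) ^ (-δ) ≤ (symmSqL i.N i.f 1).re := by
  by_cases hex : ∃ i₀ : EllipticNewformIndex, i₀.W.j = j₀
  · obtain ⟨i₀, hi₀⟩ := hex
    obtain ⟨D, hD, hDle⟩ := twistEquiv_equiv_case hδ
    have hL₀ := (symmSqL_one_re_pos i₀.f i₀.isNewformOf.peterssonProduct_re_pos).1
    have hN₀ : (0 : ℝ) < (i₀.N : ℝ) ^ (-δ) := Real.rpow_pos_of_pos (by exact_mod_cast NeZero.pos i₀.N) _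
    refine ⟨D * (i₀.N : ℝ) ^ (-δ) * (symmSqL i₀.N i₀.f 1).re, by positivity, fun i hi ↦ ?_⟩
    have hij : TwistEquiv i i₀ := by
      refine (twistEquiv_of_j_eq (i := i₀) (j := i) ?_ ?_ ?_).symm
      · rw [hi, hi₀]
      · rw [hi₀]; exact h0
      · rw [hi₀]; exact h1728
    have h := hDle i i₀ hij
    rw [Real.mul_rpow (Nat.cast_nonneg _) (Nat.cast_nonneg _)] at h
    convert h using 1
    ring
  · exact ⟨1, one_pos, fun i hi ↦ (hex ⟨i, hi⟩).elim⟩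

/-- The same bound for `symmSqLOne f = 8π³(f,f)/N ≥ Re L_f(1)` (`symmSqL_one_re_le_symmSqLOne`): the
shape of the hypothesis `hCM` of `murty_petersson_newform_lower_bound_of_pairData_nonCM`, on the
family `j = j₀`. [cite: HoffsteinLockhart1994, Thm. 0.1 (proof, the twist-equivalent case)] -/
theorem exists_symmSqLOne_ge_of_j_eq {j₀ : ℚ} (h0 : j₀ ≠ 0) (h1728 : j₀ ≠ 1728) {δ : ℝ}
    (hδ : 0 < δ) :
    ∃ c : ℝ, 0 < c ∧ ∀ i : EllipticNewformIndex, i.W.j = j₀ →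
      c * (i.N : ℝ) ^ (-δ) ≤ symmSqLOne i.f := by
  obtain ⟨c, hc, h⟩ := exists_symmSqL_one_re_ge_of_j_eq h0 h1728 hδ
  exact ⟨c, hc, fun i hi ↦ (h i hi).trans (symmSqL_one_re_le_symmSqLOne i.f)⟩

/-- **The bound on any finite set of `j`-invariants avoiding `0, 1728`** (minimum of the finitely
many constants). [cite: HoffsteinLockhart1994, Thm. 0.1 (proof, the twist-equivalent case)] -/
theorem exists_symmSqL_one_re_ge_of_j_mem (S : Finset ℚ) (h0 : (0 : ℚ) ∉ S) (h1728 : (1728 : ℚ) ∉ S)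
    {δ : ℝ} (hδ : 0 < δ) :
    ∃ c : ℝ, 0 < c ∧ ∀ i : EllipticNewformIndex, i.W.j ∈ S →
      c * (i.N : ℝ) ^ (-δ) ≤ (symmSqL i.N i.f 1).re := by
  classical
  induction S using Finset.induction_on with
  | empty => exact ⟨1, one_pos, fun i hi ↦ (Finset.notMem_empty _ hi).elim⟩
  | insert a S ha ih =>
    rw [Finset.mem_insert, not_or] at h0 h1728
    obtain ⟨c₁, hc₁, h₁⟩ := exists_symmSqL_one_re_ge_of_j_eq (Ne.symm h0.1) (Ne.symm h1728.1) hδ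
    obtain ⟨c₂, hc₂, h₂⟩ := ih h0.2 h1728.2
    refine ⟨min c₁ c₂, lt_min hc₁ hc₂, fun i hi ↦ ?_⟩
    have hN : (0 : ℝ) ≤ (i.N : ℝ) ^ (-δ) := Real.rpow_nonneg (Nat.cast_nonneg _) _
    rcases Finset.mem_insert.mp hi with hi | hi
    · exact (mul_le_mul_of_nonneg_right (min_le_left _ _) hN).trans (h₁ i hi)
    · exact (mul_le_mul_of_nonneg_right (min_le_right _ _) hN).trans (h₂ i hi)

/-- **The bound on eleven of the thirteen CM `j`-invariants** (`WeierstrassCurve.cmJInvariants`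
minus `0` and `1728`; each is a single `ℚ̄`-isomorphism class, Silverman App. C §11).
[cite: HoffsteinLockhart1994, Thm. 0.1 (proof, the twist-equivalent case)]
[cite: SilvermanAEC2009, App. C §11 Example 11.3.1] -/
theorem exists_symmSqL_one_re_ge_of_j_mem_cmJInvariants {δ : ℝ} (hδ : 0 < δ) :
    ∃ c : ℝ, 0 < c ∧ ∀ i : EllipticNewformIndex, i.W.j ∈ cmJInvariants → i.W.j ≠ 0 →
      i.W.j ≠ 1728 → c * (i.N : ℝ) ^ (-δ) ≤ (symmSqL i.N i.f 1).re := by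
  obtain ⟨c, hc, h⟩ := exists_symmSqL_one_re_ge_of_j_mem ((cmJInvariants.erase 0).erase 1728)
    (by simp) (by simp) hδ
  exact ⟨c, hc, fun i hi h0 h1728 ↦ h i (by simp [hi, h0, h1728])⟩

/-- The same for `symmSqLOne` (the shape of `hCM`). [cite: HoffsteinLockhart1994, Thm. 0.1 (proof, the twist-equivalent case)] -/
theorem exists_symmSqLOne_ge_of_j_mem_cmJInvariants {δ : ℝ} (hδ : 0 < δ) :
    ∃ c : ℝ, 0 < c ∧ ∀ i : EllipticNewformIndex, i.W.j ∈ cmJInvariants → i.W.j ≠ 0 →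
      i.W.j ≠ 1728 → c * (i.N : ℝ) ^ (-δ) ≤ symmSqLOne i.f := by
  obtain ⟨c, hc, h⟩ := exists_symmSqL_one_re_ge_of_j_mem_cmJInvariants hδ
  exact ⟨c, hc, fun i hi h0 h1728 ↦ (h i hi h0 h1728).trans (symmSqL_one_re_le_symmSqLOne i.f)⟩

/-- **Plugging the eleven CM invariants into a CM hypothesis**: a bound of the shape `hCM` of
`murty_petersson_newform_lower_bound_of_pairData_nonCM` on a sub-family `CM₀` extends to
`CM₀ ∨ (j ∈ cmJInvariants, j ≠ 0, 1728)` (take the smaller constant).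
[cite: HoffsteinLockhart1994, Thm. 0.1 (the CM case)] -/
theorem hCM_or_j_mem_cmJInvariants {CM₀ : EllipticNewformIndex → Prop}
    (h₀ : ∀ ε : ℝ, 0 < ε → ∃ c : ℝ, 0 < c ∧ ∀ j : EllipticNewformIndex, CM₀ j →
      c * (j.N : ℝ) ^ (-ε) ≤ symmSqLOne j.f) {ε : ℝ} (hε : 0 < ε) :
    ∃ c : ℝ, 0 < c ∧ ∀ j : EllipticNewformIndex,
      (CM₀ j ∨ (j.W.j ∈ cmJInvariants ∧ j.W.j ≠ 0 ∧ j.W.j ≠ 1728)) →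
        c * (j.N : ℝ) ^ (-ε) ≤ symmSqLOne j.f := by
  obtain ⟨c₁, hc₁, h₁⟩ := h₀ ε hε
  obtain ⟨c₂, hc₂, h₂⟩ := exists_symmSqLOne_ge_of_j_mem_cmJInvariants hε
  refine ⟨min c₁ c₂, lt_min hc₁ hc₂, fun j hj ↦ ?_⟩
  have hN : (0 : ℝ) ≤ (j.N : ℝ) ^ (-ε) := Real.rpow_nonneg (Nat.cast_nonneg _) _
  rcases hj with hj | ⟨hj, h0, h1728⟩
  · exact (mul_le_mul_of_nonneg_right (min_le_left _ _) hN).trans (h₁ j hj)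
  · exact (mul_le_mul_of_nonneg_right (min_le_right _ _) hN).trans (h₂ j hj h0 h1728)

/-- **Murty's bound `(f, f) ≫_ε N^{1−ε}` on every family of fixed `j`-invariant `j₀ ≠ 0, 1728`**
(`Re L_f(1) = 8π³ Re(f,f)/[SL₂(ℤ):Γ₀(N)]`, `[SL₂(ℤ):Γ₀(N)] ≥ N`): the statement of the named fact
`murty_petersson_newform_lower_bound` restricted to such a family.
[cite: MurtyCongruencePrimes1999, §2 (3)] [cite: HoffsteinLockhart1994, Thm. 0.1] -/
theorem exists_petersson_ge_of_j_eq {j₀ : ℚ} (h0 : j₀ ≠ 0) (h1728 : j₀ ≠ 1728) {ε : ℝ} (hε : 0 < ε) :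
    ∃ c : ℝ, 0 < c ∧ ∀ (N : ℕ) [NeZero N] (W : WeierstrassCurve ℚ) [W.IsElliptic]
      (f : CuspForm (Gamma0 N) 2), IsNewformOf W f → W.j = j₀ →
        c * (N : ℝ) ^ (1 - ε) ≤ (peterssonProduct (Gamma0 N) 2 f f).re := by
  obtain ⟨c, hc, h⟩ := exists_symmSqL_one_re_ge_of_j_eq h0 h1728 hε
  refine ⟨c / (8 * π ^ 3), by positivity, fun N _ W _ f hf hj ↦ ?_⟩
  have hN0 : N ≠ 0 := NeZero.ne N
  have hN : (0 : ℝ) < N := by exact_mod_cast Nat.pos_of_ne_zero hN0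
  have hidx : (N : ℝ) ≤ gamma0Index N := by exact_mod_cast le_gamma0Index hN0
  have hidx0 : (0 : ℝ) < gamma0Index N := by exact_mod_cast gamma0Index_pos N
  have hV := re_peterssonProduct_self_nonneg f
  have key := h ⟨N, W, f, hf⟩ hj
  simp only [] at key
  rw [symmSqL_one, Complex.ofReal_re] at key
  have h1 : c * (N : ℝ) ^ (-ε) ≤ 8 * π ^ 3 * (peterssonProduct (Gamma0 N) 2 f f).re / N :=
    key.trans (div_le_div_of_nonneg_left (by positivity) hN hidx)
  rw [le_div_iff₀ hN] at h1
  have hsplit : (N : ℝ) ^ (1 - ε) = (N : ℝ) ^ (-ε) * N := by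
    rw [show (1 : ℝ) - ε = -ε + 1 by ring, Real.rpow_add hN, Real.rpow_one]
  rw [hsplit, div_mul_eq_mul_div, div_le_iff₀ (by positivity)]
  nlinarith [h1]

end Bounds

end Literature.NumberTheory.EllipticCurves.ModularForms

end
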